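import Mathlib.RingTheory.AdjoinRoot
import Mathlib.RingTheory.Localization.Away.Basic
import Mathlib.RingTheory.Localization.AtPrime.Basic
import Mathlib.RingTheory.RegularLocalRing.Defs
import Mathlib.Algebra.Polynomial.Degree.SmallDegree
import Literature.AlgebraicGeometry.Resolution.AffineDomainDimension
import Literature.AlgebraicGeometry.Resolution.ExcellentRingsEssFiniteType
import HarnessLib

/-!
# The doubled hypersurface ring `R[t]/(t² − x·t)` (two copies of `Spec R` glued along `V(x)`)

Helper algebra for the crux `RadicialJung.CleanModels` (stmt-ResolutionOfSingularities-15917), line `Sketch`,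
printed stub `stub_cjs2020Thm14` (F-32): the «doubling trick» by which Cossart–Piltant 2019 Thm. 1.1 WITH its
conclusion (iii) (`CossartPiltant2019Thm11`) yields the embedded-resolution shape `hEmb` for a hypersurface
`V(x) ⊂ Spec R` of an excellent regular local threefold (memo
`Cruxes/CleanModels/Lines/Sketch-memo-hand1-printed-stubs.md` §3 (d)).  For a commutative ring `R` and `x ∈ R` put
`S = AdjoinRoot (X² − C x · X) = R[t]/(t (t − x))`: `Spec S` is the union of the two sheets `V(t) ≅ Spec R` and
`V(t − x) ≅ Spec R` meeting along `V(t, x) ≅ V(x)`.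

Content (all def-free, about Mathlib's `AdjoinRoot`): `t (t − x) = 0`; every element is `a + b t`; the two
evaluations `t ↦ 0`, `t ↦ x`; reducedness (`R` a domain, `x ≠ 0`); Krull dimension, excellence, finiteness;
`S[1/(t − x)]` and `S[1/t]` are the localisation `R[1/x]` (`IsLocalization.Away x`); at a prime containing `x` the
local ring of `S` is not a domain (so not regular).
-/

noncomputable section

open Polynomial IsLocalRing

-- lint debt: the summit's namespace repeats `ResolutionOfSingularities` (summit = problem), as in every file here.
set_option linter.dupNamespace false

namespace Summit.ResolutionOfSingularities.ResolutionOfSingularities.Theorems.RadicialJung.CleanModels.Doubling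

universe u

variable {R : Type u} [CommRing R] (x : R)

/-- `X² − x·X` is monic. [folklore] -/
theorem monic_sq_sub : (X ^ 2 - C x * X : R[X]).Monic := by
  nontriviality R
  refine (monic_X_pow 2).sub_of_left ?_
  calc (C x * X).degree ≤ 1 := by
        simpa using (degree_C_mul_X_le x)
    _ < degree ((X : R[X]) ^ 2) := by rw [degree_X_pow]; norm_num

/-- `X² − x·X` has degree `2` (over a nontrivial ring). [folklore] -/
theorem natDegree_sq_sub [Nontrivial R] : (X ^ 2 - C x * X : R[X]).natDegree = 2 := by
  rw [natDegree_sub_eq_left_of_natDegree_lt] <;> simp only [natDegree_X_pow]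
  calc (C x * X).natDegree ≤ (X : R[X]).natDegree := natDegree_C_mul_le x X
    _ ≤ 1 := natDegree_X_le
    _ < 2 := by norm_num

/-- In `S = R[t]/(t² − x t)`: `t · (t − x) = 0`. [folklore] -/
theorem root_sq : AdjoinRoot.root (X ^ 2 - C x * X) ^ 2 =
    AdjoinRoot.of _ x * AdjoinRoot.root (X ^ 2 - C x * X) := by
  have h := AdjoinRoot.mk_self (f := (X ^ 2 - C x * X : R[X]))
  rw [map_sub, map_pow, map_mul, AdjoinRoot.mk_X, AdjoinRoot.mk_C] at h
  exact sub_eq_zero.mp h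

/-- In `S = R[t]/(t² − x t)`: `t · (t − x) = 0`. [folklore] -/
theorem root_mul_root_sub :
    AdjoinRoot.root (X ^ 2 - C x * X) * (AdjoinRoot.root (X ^ 2 - C x * X) - AdjoinRoot.of _ x) = 0 := by
  have h := root_sq x
  linear_combination h

/-- `(t − x)² = −x · (t − x)` in `S`. [folklore] -/
theorem root_sub_sq : (AdjoinRoot.root (X ^ 2 - C x * X) - AdjoinRoot.of _ x) ^ 2 =
    -AdjoinRoot.of _ x * (AdjoinRoot.root (X ^ 2 - C x * X) - AdjoinRoot.of _ x) := by
  have h := root_mul_root_sub x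
  linear_combination h

/-- Every element of `S = R[t]/(t² − x t)` is `a + b·t` with `a, b ∈ R`. [folklore] -/
theorem exists_eq_of_add_of_mul_root (z : AdjoinRoot (X ^ 2 - C x * X)) :
    ∃ a b : R, z = AdjoinRoot.of _ a + AdjoinRoot.of _ b * AdjoinRoot.root (X ^ 2 - C x * X) := by
  rcases subsingleton_or_nontrivial R with hR | hR
  · haveI := Module.subsingleton R (AdjoinRoot (X ^ 2 - C x * X : R[X]))
    exact ⟨0, 0, Subsingleton.elim _ _⟩
  obtain ⟨p, rfl⟩ := AdjoinRoot.mk_surjective z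
  have hmon := monic_sq_sub x
  have hlt : (p %ₘ (X ^ 2 - C x * X)).natDegree ≤ 1 := by
    have := natDegree_modByMonic_lt p hmon (by
      intro h; have := congrArg natDegree h; rw [natDegree_sq_sub] at this; simp at this)
    rw [natDegree_sq_sub] at this
    omega
  obtain ⟨a, b, hab⟩ := exists_eq_X_add_C_of_natDegree_le_one hlt
  refine ⟨b, a, ?_⟩
  have hmk : AdjoinRoot.mk (X ^ 2 - C x * X) p = AdjoinRoot.mk _ (p %ₘ (X ^ 2 - C x * X)) := by
    conv_lhs => rw [← AdjoinRoot.mk_leftInverse hmon (AdjoinRoot.mk _ p)]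
    rw [AdjoinRoot.modByMonicHom_mk]
  rw [hmk, hab, map_add, map_mul, AdjoinRoot.mk_C, AdjoinRoot.mk_C, AdjoinRoot.mk_X]
  ring

/-- The evaluation `t ↦ 0` is well defined: `X² − x X` vanishes at `0`. [folklore] -/
theorem eval₂_zero : (X ^ 2 - C x * X : R[X]).eval₂ (RingHom.id R) 0 = 0 := by simp

/-- The evaluation `t ↦ x` is well defined: `X² − x X` vanishes at `x`. [folklore] -/
theorem eval₂_at : (X ^ 2 - C x * X : R[X]).eval₂ (RingHom.id R) x = 0 := by simp [sq]

/-- `S` is module-finite over `R` (basis `1, t`). [folklore] -/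
theorem moduleFinite : Module.Finite R (AdjoinRoot (X ^ 2 - C x * X)) :=
  (monic_sq_sub x).finite_adjoinRoot

/-- `S` is a finite-type `R`-algebra. [folklore] -/
theorem finiteType : Algebra.FiniteType R (AdjoinRoot (X ^ 2 - C x * X)) :=
  haveI := moduleFinite x
  Module.Finite.finiteType (AdjoinRoot (X ^ 2 - C x * X))

/-- `R → S` is injective (`R` a domain). [folklore] -/
theorem of_injective [IsDomain R] : Function.Injective (AdjoinRoot.of (X ^ 2 - C x * X)) := by
  apply AdjoinRoot.of.injective_of_degree_ne_zero
  rw [degree_eq_natDegree (monic_sq_sub x).ne_zero, natDegree_sq_sub]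
  norm_num

/-- `S = R[t]/(t² − x t)` is reduced when `R` is a domain and `x ≠ 0`: an element `a + b t` killed by both
evaluations `t ↦ 0`, `t ↦ x` has `a = 0` and `b x = 0`. [folklore] -/
theorem isReduced [IsDomain R] (hx : x ≠ 0) : IsReduced (AdjoinRoot (X ^ 2 - C x * X)) := by
  refine ⟨fun z hz => ?_⟩
  obtain ⟨a, b, rfl⟩ := exists_eq_of_add_of_mul_root x z
  set ev0 := AdjoinRoot.lift (RingHom.id R) (0 : R) (eval₂_zero x) with hev0
  set evx := AdjoinRoot.lift (RingHom.id R) x (eval₂_at x) with hevx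
  have h0 : a = 0 := by
    have := (hz.map ev0).eq_zero
    simpa [hev0, AdjoinRoot.lift_of, AdjoinRoot.lift_root] using this
  have h1 : a + b * x = 0 := by
    have := (hz.map evx).eq_zero
    simpa [hevx, AdjoinRoot.lift_of, AdjoinRoot.lift_root] using this
  subst h0
  have hb : b = 0 := by
    rw [zero_add] at h1
    exact (mul_eq_zero.mp h1).resolve_right hx
  subst hb
  simp

/-- `dim S = dim R` (`S` is finite over `R`, injectively when `R` is a domain). [cite: Matsumura1987, Thm. 9.4] -/
theorem ringKrullDim_eq [IsDomain R] :
    ringKrullDim (AdjoinRoot (X ^ 2 - C x * X)) = ringKrullDim R := by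
  haveI := moduleFinite x
  haveI : Algebra.IsIntegral R (AdjoinRoot (X ^ 2 - C x * X)) := inferInstance
  exact Literature.AlgebraicGeometry.Resolution.ringKrullDim_eq_of_isIntegral
    (by simpa [AdjoinRoot.algebraMap_eq] using of_injective x)

/-- `S` is excellent when `R` is. [cite: Matsumura1987, §32 p. 260] -/
theorem isExcellentRing (hR : Literature.AlgebraicGeometry.Resolution.IsExcellentRing R) :
    Literature.AlgebraicGeometry.Resolution.IsExcellentRing (AdjoinRoot (X ^ 2 - C x * X)) :=
  haveI := finiteType x
  hR.of_finiteType'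


/-! ## Primes of `S` and the element `x` -/

/-- At a prime of `S` containing `x`, both `t` and `t − x` lie in the prime (`t² = x t`). [folklore] -/
theorem root_mem_of_mem (P : Ideal (AdjoinRoot (X ^ 2 - C x * X))) [P.IsPrime]
    (hP : AdjoinRoot.of _ x ∈ P) :
    AdjoinRoot.root (X ^ 2 - C x * X) ∈ P ∧ AdjoinRoot.root (X ^ 2 - C x * X) - AdjoinRoot.of _ x ∈ P := by
  have h1 : AdjoinRoot.root (X ^ 2 - C x * X) ∈ P := by
    apply Ideal.IsPrime.mem_of_pow_mem ‹_› 2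
    rw [root_sq]
    exact P.mul_mem_right _ hP
  exact ⟨h1, P.sub_mem h1 hP⟩

/-- At a prime of `S` not containing `x`, exactly one of `t`, `t − x` lies in the prime. [folklore] -/
theorem root_mem_or_of_not_mem (P : Ideal (AdjoinRoot (X ^ 2 - C x * X))) [P.IsPrime]
    (hP : AdjoinRoot.of _ x ∉ P) :
    (AdjoinRoot.root (X ^ 2 - C x * X) ∈ P ∧ AdjoinRoot.root (X ^ 2 - C x * X) - AdjoinRoot.of _ x ∉ P) ∨
    (AdjoinRoot.root (X ^ 2 - C x * X) ∉ P ∧ AdjoinRoot.root (X ^ 2 - C x * X) - AdjoinRoot.of _ x ∈ P) := by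
  have h0 := root_mul_root_sub x
  have hor := (Ideal.IsPrime.mem_or_mem ‹_› (h0.symm ▸ P.zero_mem :
    AdjoinRoot.root (X ^ 2 - C x * X) * (AdjoinRoot.root (X ^ 2 - C x * X) - AdjoinRoot.of _ x) ∈ P))
  have key : ¬ (AdjoinRoot.root (X ^ 2 - C x * X) ∈ P ∧
      AdjoinRoot.root (X ^ 2 - C x * X) - AdjoinRoot.of _ x ∈ P) := by
    rintro ⟨h1, h2⟩
    apply hP
    have := P.sub_mem h1 h2
    simpa using this
  tauto

/-- The multiples of `t` killed in `S`: `(a + b t) · t = 0` forces `(a + b x) x = 0` in `R`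
(apply `t ↦ x`). [folklore] -/
theorem eval_at_mul_of_mul_root_eq_zero {a b : R}
    (h : (AdjoinRoot.of _ a + AdjoinRoot.of _ b * AdjoinRoot.root (X ^ 2 - C x * X)) *
      AdjoinRoot.root (X ^ 2 - C x * X) = 0) : (a + b * x) * x = 0 := by
  have := congrArg (AdjoinRoot.lift (RingHom.id R) x (eval₂_at x)) h
  simpa [AdjoinRoot.lift_of, AdjoinRoot.lift_root] using this

/-- `(a + b t) · (t − x) = 0` forces `a x = 0` in `R` (apply `t ↦ 0`). [folklore] -/
theorem eval_zero_mul_of_mul_root_sub_eq_zero {a b : R}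
    (h : (AdjoinRoot.of _ a + AdjoinRoot.of _ b * AdjoinRoot.root (X ^ 2 - C x * X)) *
      (AdjoinRoot.root (X ^ 2 - C x * X) - AdjoinRoot.of _ x) = 0) : a * x = 0 := by
  have := congrArg (AdjoinRoot.lift (RingHom.id R) (0 : R) (eval₂_zero x)) h
  simp [AdjoinRoot.lift_of, AdjoinRoot.lift_root] at this
  linear_combination this

/-- **At a prime `P ∋ x` of `S` the local ring `S_P` is not a domain** (`R` a domain, `x ≠ 0`): the images of
`t` and `t − x` are non-zero with product zero — two sheets meet along `V(x)`. [folklore] -/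
theorem not_isDomain_localization_of_mem [IsDomain R] (hx : x ≠ 0)
    (P : Ideal (AdjoinRoot (X ^ 2 - C x * X))) [P.IsPrime] (hP : AdjoinRoot.of _ x ∈ P) :
    ¬ IsDomain (Localization.AtPrime P) := by
  intro hdom
  obtain ⟨hr, hs⟩ := root_mem_of_mem x P hP
  set S := AdjoinRoot (X ^ 2 - C x * X)
  have hprod : algebraMap S (Localization.AtPrime P) (AdjoinRoot.root (X ^ 2 - C x * X)) *
      algebraMap S (Localization.AtPrime P) (AdjoinRoot.root (X ^ 2 - C x * X) - AdjoinRoot.of _ x) = 0 := by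
    rw [← map_mul, root_mul_root_sub, map_zero]
  rcases mul_eq_zero.mp hprod with h | h
  · obtain ⟨⟨u, hu⟩, hu0⟩ := (IsLocalization.map_eq_zero_iff P.primeCompl _ _).mp h
    obtain ⟨a, b, rfl⟩ := exists_eq_of_add_of_mul_root x u
    have hab : (a + b * x) * x = 0 := eval_at_mul_of_mul_root_eq_zero x hu0
    have hab' : a = -(b * x) := by
      have := (mul_eq_zero.mp hab).resolve_right hx
      linear_combination this
    apply hu
    have : AdjoinRoot.of _ a + AdjoinRoot.of _ b * AdjoinRoot.root (X ^ 2 - C x * X) =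
        AdjoinRoot.of _ b * (AdjoinRoot.root (X ^ 2 - C x * X) - AdjoinRoot.of _ x) := by
      rw [hab', map_neg, map_mul]; ring
    rw [this]
    exact P.mul_mem_left _ hs
  · obtain ⟨⟨u, hu⟩, hu0⟩ := (IsLocalization.map_eq_zero_iff P.primeCompl _ _).mp h
    obtain ⟨a, b, rfl⟩ := exists_eq_of_add_of_mul_root x u
    have ha : a * x = 0 := eval_zero_mul_of_mul_root_sub_eq_zero x hu0
    have ha' : a = 0 := (mul_eq_zero.mp ha).resolve_right hx
    apply hu
    rw [ha', map_zero, zero_add]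
    exact P.mul_mem_left _ hr

/-! ## Local rings of `S` off `V(x)` are local rings of `R` -/

/-- **On the sheet `t = 0`, off `V(x)`**: at a prime `P` of `S` with `t − x ∉ P`, `S_P` is the localisation of
`R` at `P ∩ R` (in `S_P`, `t = 0`). [folklore] -/
theorem isLocalization_atPrime_comap_of_root_sub_not_mem
    (P : Ideal (AdjoinRoot (X ^ 2 - C x * X))) [P.IsPrime]
    (hs : AdjoinRoot.root (X ^ 2 - C x * X) - AdjoinRoot.of _ x ∉ P) :
    IsLocalization.AtPrime (Localization.AtPrime P) (P.comap (algebraMap R (AdjoinRoot (X ^ 2 - C x * X)))) := by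
  have hr : AdjoinRoot.root (X ^ 2 - C x * X) ∈ P := by
    rcases Ideal.IsPrime.mem_or_mem ‹P.IsPrime› ((root_mul_root_sub x).symm ▸ P.zero_mem :
      AdjoinRoot.root (X ^ 2 - C x * X) * (AdjoinRoot.root (X ^ 2 - C x * X) - AdjoinRoot.of _ x) ∈ P) with h | h
    · exact h
    · exact absurd h hs
  have halg : ∀ r : R, algebraMap R (Localization.AtPrime P) r =
      algebraMap (AdjoinRoot (X ^ 2 - C x * X)) (Localization.AtPrime P) (AdjoinRoot.of _ r) := fun r => by
    rw [IsScalarTower.algebraMap_apply R (AdjoinRoot (X ^ 2 - C x * X)) (Localization.AtPrime P),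
      AdjoinRoot.algebraMap_eq]
  have hmemR : ∀ r : R, r ∈ P.comap (algebraMap R (AdjoinRoot (X ^ 2 - C x * X))) ↔ AdjoinRoot.of _ r ∈ P :=
    fun r => by rw [Ideal.mem_comap, AdjoinRoot.algebraMap_eq]
  -- in `S_P`, `t = 0` since `t (t - x) = 0` and `t - x` is a unit
  have hroot : algebraMap (AdjoinRoot (X ^ 2 - C x * X)) (Localization.AtPrime P)
      (AdjoinRoot.root (X ^ 2 - C x * X)) = 0 := by
    have hu : IsUnit (algebraMap (AdjoinRoot (X ^ 2 - C x * X)) (Localization.AtPrime P)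
        (AdjoinRoot.root (X ^ 2 - C x * X) - AdjoinRoot.of _ x)) :=
      IsLocalization.map_units (Localization.AtPrime P) (⟨_, show _ ∈ P.primeCompl from hs⟩ : P.primeCompl)
    have := congrArg (algebraMap (AdjoinRoot (X ^ 2 - C x * X)) (Localization.AtPrime P)) (root_mul_root_sub x)
    rw [map_mul, map_zero] at this
    exact (hu.mul_left_eq_zero).mp this
  refine (isLocalization_iff _ _).mpr ⟨?_, ?_, ?_⟩
  · rintro ⟨r, hr'⟩
    rw [halg]
    refine IsLocalization.map_units (Localization.AtPrime P) (⟨AdjoinRoot.of _ r, ?_⟩ : P.primeCompl)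
    exact fun h => hr' ((hmemR r).mpr h)
  · intro z
    obtain ⟨⟨w, ⟨u, hu⟩⟩, hz⟩ := IsLocalization.surj P.primeCompl z
    obtain ⟨a, b, rfl⟩ := exists_eq_of_add_of_mul_root x w
    obtain ⟨c, d, rfl⟩ := exists_eq_of_add_of_mul_root x u
    have hc : c ∈ (P.comap (algebraMap R (AdjoinRoot (X ^ 2 - C x * X)))).primeCompl := by
      intro hc
      exact hu (P.add_mem ((hmemR c).mp hc) (P.mul_mem_left _ hr))
    refine ⟨⟨a, ⟨c, hc⟩⟩, ?_⟩
    simp only at hz ⊢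
    rw [halg, halg]
    rw [map_add, map_mul, map_add, map_mul, hroot, mul_zero, add_zero, mul_zero, add_zero] at hz
    exact hz
  · intro r₁ r₂ h
    rw [halg, halg] at h
    obtain ⟨⟨u, hu⟩, hu'⟩ := (IsLocalization.eq_iff_exists P.primeCompl (Localization.AtPrime P)).mp h
    obtain ⟨c, d, rfl⟩ := exists_eq_of_add_of_mul_root x u
    have hc : c ∈ (P.comap (algebraMap R (AdjoinRoot (X ^ 2 - C x * X)))).primeCompl := by
      intro hc
      exact hu (P.add_mem ((hmemR c).mp hc) (P.mul_mem_left _ hr))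
    refine ⟨⟨c, hc⟩, ?_⟩
    have := congrArg (AdjoinRoot.lift (RingHom.id R) (0 : R) (eval₂_zero x)) hu'
    simpa [AdjoinRoot.lift_of, AdjoinRoot.lift_root] using this

/-- **On the sheet `t = x`, off `V(x)`**: at a prime `P` of `S` with `t ∉ P`, `S_P` is the localisation of `R` at
`P ∩ R` (in `S_P`, `t = x`). [folklore] -/
theorem isLocalization_atPrime_comap_of_root_not_mem
    (P : Ideal (AdjoinRoot (X ^ 2 - C x * X))) [P.IsPrime]
    (hr : AdjoinRoot.root (X ^ 2 - C x * X) ∉ P) :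
    IsLocalization.AtPrime (Localization.AtPrime P) (P.comap (algebraMap R (AdjoinRoot (X ^ 2 - C x * X)))) := by
  have hs : AdjoinRoot.root (X ^ 2 - C x * X) - AdjoinRoot.of _ x ∈ P := by
    rcases Ideal.IsPrime.mem_or_mem ‹P.IsPrime› ((root_mul_root_sub x).symm ▸ P.zero_mem :
      AdjoinRoot.root (X ^ 2 - C x * X) * (AdjoinRoot.root (X ^ 2 - C x * X) - AdjoinRoot.of _ x) ∈ P) with h | h
    · exact absurd h hr
    · exact h
  have halg : ∀ r : R, algebraMap R (Localization.AtPrime P) r =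
      algebraMap (AdjoinRoot (X ^ 2 - C x * X)) (Localization.AtPrime P) (AdjoinRoot.of _ r) := fun r => by
    rw [IsScalarTower.algebraMap_apply R (AdjoinRoot (X ^ 2 - C x * X)) (Localization.AtPrime P),
      AdjoinRoot.algebraMap_eq]
  have hmemR : ∀ r : R, r ∈ P.comap (algebraMap R (AdjoinRoot (X ^ 2 - C x * X))) ↔ AdjoinRoot.of _ r ∈ P :=
    fun r => by rw [Ideal.mem_comap, AdjoinRoot.algebraMap_eq]
  -- in `S_P`, `t = x` since `t (t - x) = 0` and `t` is a unit
  have hroot : algebraMap (AdjoinRoot (X ^ 2 - C x * X)) (Localization.AtPrime P)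
      (AdjoinRoot.root (X ^ 2 - C x * X)) =
      algebraMap (AdjoinRoot (X ^ 2 - C x * X)) (Localization.AtPrime P) (AdjoinRoot.of _ x) := by
    have hu : IsUnit (algebraMap (AdjoinRoot (X ^ 2 - C x * X)) (Localization.AtPrime P)
        (AdjoinRoot.root (X ^ 2 - C x * X))) :=
      IsLocalization.map_units (Localization.AtPrime P) (⟨_, show _ ∈ P.primeCompl from hr⟩ : P.primeCompl)
    have := congrArg (algebraMap (AdjoinRoot (X ^ 2 - C x * X)) (Localization.AtPrime P)) (root_mul_root_sub x)
    rw [map_mul, map_zero] at this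
    have h2 := (hu.mul_right_eq_zero).mp this
    rwa [map_sub, sub_eq_zero] at h2
  -- the key identity `c + d t ≡ (c + d x) + d (t - x)`
  have hsplit : ∀ c d : R, AdjoinRoot.of _ c + AdjoinRoot.of _ d * AdjoinRoot.root (X ^ 2 - C x * X) =
      AdjoinRoot.of _ (c + d * x) + AdjoinRoot.of _ d * (AdjoinRoot.root (X ^ 2 - C x * X) - AdjoinRoot.of _ x) := by
    intro c d
    rw [map_add, map_mul]; ring
  refine (isLocalization_iff _ _).mpr ⟨?_, ?_, ?_⟩
  · rintro ⟨r, hr'⟩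
    rw [halg]
    refine IsLocalization.map_units (Localization.AtPrime P) (⟨AdjoinRoot.of _ r, ?_⟩ : P.primeCompl)
    exact fun h => hr' ((hmemR r).mpr h)
  · intro z
    obtain ⟨⟨w, ⟨u, hu⟩⟩, hz⟩ := IsLocalization.surj P.primeCompl z
    obtain ⟨a, b, rfl⟩ := exists_eq_of_add_of_mul_root x w
    obtain ⟨c, d, rfl⟩ := exists_eq_of_add_of_mul_root x u
    have hc : c + d * x ∈ (P.comap (algebraMap R (AdjoinRoot (X ^ 2 - C x * X)))).primeCompl := by
      intro hc
      apply hu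
      rw [hsplit]
      exact P.add_mem ((hmemR _).mp hc) (P.mul_mem_left _ hs)
    refine ⟨⟨a + b * x, ⟨c + d * x, hc⟩⟩, ?_⟩
    simp only at hz ⊢
    rw [halg, halg, map_add (AdjoinRoot.of _), map_mul (AdjoinRoot.of _), map_add (AdjoinRoot.of _),
      map_mul (AdjoinRoot.of _)]
    rw [map_add, map_mul, map_add, map_mul, hroot] at hz
    simpa only [map_add, map_mul] using hz
  · intro r₁ r₂ h
    rw [halg, halg] at h
    obtain ⟨⟨u, hu⟩, hu'⟩ := (IsLocalization.eq_iff_exists P.primeCompl (Localization.AtPrime P)).mp h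
    obtain ⟨c, d, rfl⟩ := exists_eq_of_add_of_mul_root x u
    have hc : c + d * x ∈ (P.comap (algebraMap R (AdjoinRoot (X ^ 2 - C x * X)))).primeCompl := by
      intro hc
      apply hu
      rw [hsplit]
      exact P.add_mem ((hmemR _).mp hc) (P.mul_mem_left _ hs)
    refine ⟨⟨c + d * x, hc⟩, ?_⟩
    have := congrArg (AdjoinRoot.lift (RingHom.id R) x (eval₂_at x)) hu'
    simpa [AdjoinRoot.lift_of, AdjoinRoot.lift_root] using this

/-- **Off `V(x)` the local rings of `S` are regular** when `R` is a regular ring: `S_P ≅ R_{P ∩ R}`.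
[folklore] -/
theorem isRegularLocalRing_localization_of_not_mem [IsRegularRing R]
    (P : Ideal (AdjoinRoot (X ^ 2 - C x * X))) [P.IsPrime] (hP : AdjoinRoot.of _ x ∉ P) :
    IsRegularLocalRing (Localization.AtPrime P) := by
  set p := P.comap (algebraMap R (AdjoinRoot (X ^ 2 - C x * X)))
  have hreg : IsRegularLocalRing (Localization.AtPrime p) := IsRegularRing.isRegularLocalRing_localization p
  rcases root_mem_or_of_not_mem x P hP with ⟨-, hs⟩ | ⟨hr, -⟩
  · haveI := isLocalization_atPrime_comap_of_root_sub_not_mem x P hs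
    exact IsRegularLocalRing.of_ringEquiv
      (IsLocalization.algEquiv p.primeCompl (Localization.AtPrime p) (Localization.AtPrime P)).toRingEquiv
  · haveI := isLocalization_atPrime_comap_of_root_not_mem x P hr
    exact IsRegularLocalRing.of_ringEquiv
      (IsLocalization.algEquiv p.primeCompl (Localization.AtPrime p) (Localization.AtPrime P)).toRingEquiv

end Summit.ResolutionOfSingularities.ResolutionOfSingularities.Theorems.RadicialJung.CleanModels.Doubling

end
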